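import Literature.Computability.Cryptography.HallgrenCycle
import Literature.Computability.Cryptography.HallgrenCandidateCheck
import Literature.Computability.Cryptography.HallgrenRegulatorBounds
import HarnessLib

/-!
# The walk parameters of Hallgren's algorithm and their adequacy

Topic `Computability/Cryptography`; fixes, as explicit functions of the discriminant `D` (so of the
input), the parameters of the integer walk on `hallgrenCycle` (`HallgrenCycle.lean`) — start-up
rounds `s₀`, doubling levels `T`, final rounds `2M`, precision `p` — and proves the adequacy
hypotheses consumed by the candidate check (`HallgrenCandidateCheck.passes_complete`,
`HallgrenPostCorrect.exists_true_cand`): the start-up passes `2K + 1`, the doublings reach past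
`R + 2`, the residual is below `M(L − 2η)`, and the distance error budget
`E_fin + 2η ≤ 2⁻¹⁰` (Jozsa 2003, §9 proof of Thm. 5: "N₀ = O(log D) … n = O(poly log D) digits of
accuracy suffice"). Theorem-and-definition file, no named facts.

## References

* R. Jozsa, arXiv:quant-ph/0302134 (2003), §9 (Thm. 5 and its proof). [Jozsa2003]
-/

noncomputable section

open scoped Classical

namespace Literature.Computability.Cryptography

namespace HallgrenGiantStep

open Literature.NumberTheory.QuadraticFields Literature.NumberTheory.QuadraticFields.QuadIrr
  InfraPrimitives PrincipalCycle GiantStepCycle WalkData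

/-! ### The parameters -/

/-- Start-up rounds `s₀ = 16(2K(D) + 3)`. [cite: Jozsa2003, §9 (N₀)] -/
def s0Of (D : ℕ) : ℕ := 2 * (4 * (2 * KQn D + 3))

/-- The least useful number of doubling levels `3 size D + 4` (reaches `R + 2`); the walk is run with
any `T` at least this (the table must reach `Q/N`). [cite: Jozsa2003, §9 (2^N R)] -/
def TOf (D : ℕ) : ℕ := 3 * D.size + 4

/-- Half the final rounds `M = 4((2T + 3)(K(D) + 2) + size D + 3) + 4`. [cite: Jozsa2003, §9] -/
def MOf (D T : ℕ) : ℕ := 4 * ((2 * T + 3) * (KQn D + 2) + D.size + 3) + 4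

/-- The error-budget exponent. [folklore] -/
def XOf (D T : ℕ) : ℕ := T * (s0Of D + 1) + T + 2 * MOf D T + 2

/-- Precision `p = T + size X + size(4 size D + 29) + 10`. [cite: Jozsa2003, §9 Thm. 5 ("sufficient accuracy")] -/
def precOf (D T : ℕ) : ℕ := T + (XOf D T).size + (4 * D.size + 29).size + 10

/-- **The precision is adequate for the cycle**: `8(4 size D + 29) ≤ 2ᵖ`. [folklore] -/
theorem prec_ok (D T : ℕ) : 8 * (4 * D.size + 29) ≤ 2 ^ precOf D T := by
  unfold precOf
  have h1 : 4 * D.size + 29 < 2 ^ (4 * D.size + 29).size := Nat.lt_size_self _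
  calc 8 * (4 * D.size + 29) ≤ 2 ^ 3 * 2 ^ (4 * D.size + 29).size := by
        rw [show (8 : ℕ) = 2 ^ 3 by norm_num]; exact Nat.mul_le_mul_left _ h1.le
    _ = 2 ^ (3 + (4 * D.size + 29).size) := by rw [pow_add]
    _ ≤ 2 ^ (T + (XOf D T).size + (4 * D.size + 29).size + 10) := Nat.pow_le_pow_right (by norm_num) (by omega)

/-- More precision is still adequate. [folklore] -/
theorem prec_ok' (D T j : ℕ) : 8 * (4 * D.size + 29) ≤ 2 ^ (precOf D T + j) :=
  (prec_ok D T).trans (Nat.pow_le_pow_right (by norm_num) (Nat.le_add_right _ _))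

variable {D : ℕ} (hD : ¬ IsSquare D) (hD4 : D % 4 = 0 ∨ D % 4 = 1)

/-- The cycle with `T` doubling levels and the chosen precision plus `j` extra bits. [folklore] -/
abbrev cyc (hD : ¬ IsSquare D) (hD4 : D % 4 = 0 ∨ D % 4 = 1) (T j : ℕ) : GiantStepCycle (ℤ × ℤ) :=
  hallgrenCycle hD hD4 (precOf D T + j) (prec_ok' D T j)

variable (T j : ℕ)

include hD hD4

/-! ### The fields of the cycle -/

/-- `K = K(D) + 1`. [folklore] -/
theorem cyc_K : ((cyc hD hD4 T j).K : ℝ) = KQn D + 1 := by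
  show ((((KIntG (D, precOf D T + j) : ℕ) : ℚ) / 2 ^ (precOf D T + j) : ℚ) : ℝ) = KQn D + 1
  unfold KIntG; push_cast; field_simp

/-- `η = (4 size D + 29)/2ᵖ⁺ʲ`. [folklore] -/
theorem cyc_η : (cyc hD hD4 T j).η = (4 * D.size + 29) / (2 : ℝ) ^ (precOf D T + j) := rfl

/-- `L = log 2`. [folklore] -/
theorem cyc_L : (cyc hD hD4 T j).L = Real.log 2 := rfl

/-- `G = log (2√D)`. [folklore] -/
theorem cyc_G : (cyc hD hD4 T j).G = Real.log (2 * Real.sqrt D) := rfl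

/-- `R = log ε`. [folklore] -/
theorem cyc_R : (cyc hD hD4 T j).R = Real.log (fundUnit D) := rfl

/-- `η ≤ 1/8` and `L − 2η ≥ 1/4`. [folklore] -/
theorem quarter_le_L_sub : (cyc hD hD4 T j).η ≤ 1 / 8 ∧ (1 : ℝ) / 4 ≤ (cyc hD hD4 T j).L - 2 * (cyc hD hD4 T j).η := by
  have hη := (cyc hD hD4 T j).η_le
  have h2 := Real.one_sub_inv_le_log_of_pos (by norm_num : (0 : ℝ) < 2)
  rw [cyc_L]
  norm_num at h2
  constructor <;> linarith

/-- `log D ≤ size D` and `G ≤ size D + 2`. [folklore] -/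
theorem G_le : Real.log D ≤ D.size ∧ (cyc hD hD4 T j).G ≤ D.size + 2 := by
  have hD1 : (1 : ℝ) ≤ D := by exact_mod_cast le_trans (by norm_num) (five_le hD hD4)
  have hlog : Real.log D ≤ D.size := by
    have hlt : (D : ℝ) < (2 : ℝ) ^ D.size := by exact_mod_cast Nat.lt_size_self D
    have h1 := Real.log_le_log (by linarith) hlt.le
    rw [Real.log_pow] at h1
    have h2 : Real.log 2 ≤ 1 := by have := Real.log_le_sub_one_of_pos (by norm_num : (0 : ℝ) < 2); linarith
    have h3 : (0 : ℝ) ≤ D.size := Nat.cast_nonneg _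
    nlinarith
  refine ⟨hlog, ?_⟩
  rw [cyc_G, Real.log_mul (by norm_num) (by positivity), Real.log_sqrt (by positivity)]
  have := Real.log_le_sub_one_of_pos (by norm_num : (0 : ℝ) < 2)
  have : 0 ≤ Real.log D := Real.log_nonneg hD1
  linarith

/-! ### Adequacy -/

/-- **The start-up passes `2K + 1`.** [cite: Jozsa2003, §9 (choice of N₀)] -/
theorem start_ok : 2 * (cyc hD hD4 T j).K + 1 ≤ ((cyc hD hD4 T j).start (s0Of D)).2 := by
  refine (cyc hD hD4 T j).le_start (j := 4 * (2 * KQn D + 3)) ?_ (by unfold s0Of; omega)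
  obtain ⟨-, hL⟩ := quarter_le_L_sub hD hD4 T j
  rw [cyc_K hD hD4 T j]
  have h0 : (0 : ℝ) ≤ KQn D := Nat.cast_nonneg _
  push_cast
  nlinarith

/-- **The doublings reach `2^T · 7/8`.** [cite: Jozsa2003, §9 (I_N)] -/
theorem reach_ok' {x : ℝ} (hx : x ≤ (2 : ℝ) ^ T * (7 / 8)) : x ≤ ((cyc hD hD4 T j).dbl (s0Of D) T).2 :=
  (cyc hD hD4 T j).le_dbl_of_le_two_pow (start_ok hD hD4 T j) hx

/-- **The doublings reach past `R + 2`** once `T ≥ 3 size D + 4`. [cite: Jozsa2003, §9 (I_N with 2^N > R)] -/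
theorem reach_ok (hT : TOf D ≤ T) {x : ℝ} (hx : x ≤ Real.log (fundUnit D) + 2) : x ≤ ((cyc hD hD4 T j).dbl (s0Of D) T).2 := by
  refine reach_ok' hD hD4 T j (hx.trans ?_)
  -- `R + 2 ≤ 2^{3 size D + 3} ≤ 2^T · 7/8`
  have hR := HallgrenRegulator.log_fundUnit_le hD hD4
  obtain ⟨hlog, -⟩ := G_le hD hD4 T j
  have hD1 : (1 : ℝ) ≤ D := by exact_mod_cast le_trans (by norm_num) (five_le hD hD4)
  have hDs : (D : ℝ) < (2 : ℝ) ^ D.size := by exact_mod_cast Nat.lt_size_self D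
  have hs1 : ((D.size : ℕ) : ℝ) + 1 ≤ (2 : ℝ) ^ D.size := by exact_mod_cast Nat.lt_two_pow_self
  have h2s : (1 : ℝ) ≤ (2 : ℝ) ^ D.size := one_le_pow₀ (by norm_num)
  have hsq : (((2 * D + 2) ^ 2 : ℕ) : ℝ) ≤ 4 * ((2 : ℝ) ^ D.size) ^ 2 := by
    have hn : (2 * D + 2) ^ 2 ≤ 4 * (2 ^ D.size) ^ 2 := by
      have := Nat.lt_size_self D; nlinarith
    exact_mod_cast hn
  have hRle : Real.log (fundUnit D) ≤ 4 * ((2 : ℝ) ^ D.size) ^ 2 * (2 : ℝ) ^ D.size := by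
    refine hR.trans ?_
    have h0 : 0 ≤ 1 + Real.log D := by have := Real.log_nonneg hD1; linarith
    calc (((2 * D + 2) ^ 2 : ℕ) : ℝ) * (1 + Real.log D) ≤ (4 * ((2 : ℝ) ^ D.size) ^ 2) * ((2 : ℝ) ^ D.size) :=
          mul_le_mul hsq (by linarith) h0 (by positivity)
      _ = _ := by ring
  have hT2 : (2 : ℝ) ^ (3 * D.size + 4) ≤ (2 : ℝ) ^ T := pow_le_pow_right₀ (by norm_num) (by unfold TOf at hT; omega)
  rw [show (2 : ℝ) ^ (3 * D.size + 4) = 16 * (((2 : ℝ) ^ D.size) ^ 2 * (2 : ℝ) ^ D.size) by ring] at hT2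
  nlinarith

/-- **The residual of the descent is below `M(L − 2η)`.** [cite: Jozsa2003, §9] -/
theorem res_ok : (cyc hD hD4 T j).Res (s0Of D) T < (MOf D T) * ((cyc hD hD4 T j).L - 2 * (cyc hD hD4 T j).η) := by
  have hres := (cyc hD hD4 T j).Res_le (s0Of D) T
  obtain ⟨hη, hL⟩ := quarter_le_L_sub hD hD4 T j
  obtain ⟨-, hG⟩ := G_le hD hD4 T j
  have hK := cyc_K hD hD4 T j
  have hK0 : (0 : ℝ) ≤ KQn D := Nat.cast_nonneg _
  have hT0 : (0 : ℝ) ≤ T := Nat.cast_nonneg _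
  -- `Res ≤ Y := (2T+3)(KQn+2) + size D + 3`, and `M(L − 2η) ≥ M/4 = Y + 1`
  set Y : ℝ := (2 * (T : ℝ) + 3) * (KQn D + 2) + D.size + 3 with hY
  have hbound : (cyc hD hD4 T j).Res (s0Of D) T ≤ Y := by
    rw [hK] at hres
    have hη0 := (cyc hD hD4 T j).η_nonneg
    rw [hY]; nlinarith
  have hM : ((MOf D T : ℕ) : ℝ) = 4 * Y + 4 := by unfold MOf; rw [hY]; push_cast; ring
  rw [hM]
  have hpos : 0 ≤ Y := by rw [hY]; positivity
  nlinarith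

/-- **The distance error budget**: `E_fin(s₀, T, 2M) + 2η ≤ 2⁻¹⁰`. [cite: Jozsa2003, §9 Thm. 5 ("to n digits of accuracy")] -/
theorem Efin_budget : (cyc hD hD4 T j).Efin (s0Of D) T (2 * MOf D T) + 2 * (cyc hD hD4 T j).η ≤ 1 / (1024 * (2 : ℝ) ^ j) := by
  -- `Efin + 2η = Etot(s₀, T, 2M + 1) ≤ (T 2^T (s₀+1) + T + 2M + 2) η`
  have h1 : (cyc hD hD4 T j).Efin (s0Of D) T (2 * MOf D T) + 2 * (cyc hD hD4 T j).η =
      (cyc hD hD4 T j).Etot (s0Of D) T (2 * MOf D T + 1) := by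
    unfold GiantStepCycle.Efin GiantStepCycle.Etot; push_cast; ring
  rw [h1]
  refine ((cyc hD hD4 T j).Etot_le _ _ _).trans ?_
  rw [cyc_η]
  have hη0 : (0 : ℝ) ≤ (4 * D.size + 29 : ℝ) := by positivity
  -- numerator `≤ 2^T · X`, and `X < 2^{size X}`, `4 size D + 29 < 2^{size(…)}`
  have hX : ((T : ℕ) : ℝ) * 2 ^ T * (((s0Of D : ℕ) : ℝ) + 1) + T + ((2 * MOf D T + 1 : ℕ) : ℝ) + 1 ≤
      (2 : ℝ) ^ T * (XOf D T : ℕ) := by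
    have h2T : (1 : ℝ) ≤ (2 : ℝ) ^ T := one_le_pow₀ (by norm_num)
    unfold XOf; push_cast
    have hT0 : (0 : ℝ) ≤ T := Nat.cast_nonneg _
    have hs0 : (0 : ℝ) ≤ s0Of D := Nat.cast_nonneg _
    have hM0 : (0 : ℝ) ≤ MOf D T := Nat.cast_nonneg _
    nlinarith
  have hXs : ((XOf D T : ℕ) : ℝ) ≤ (2 : ℝ) ^ (XOf D T).size := by exact_mod_cast (Nat.lt_size_self _).le
  have hKs : (4 * D.size + 29 : ℝ) ≤ (2 : ℝ) ^ (4 * D.size + 29).size := by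
    exact_mod_cast (Nat.lt_size_self (4 * D.size + 29)).le
  have hp : (2 : ℝ) ^ (precOf D T + j) = (2 : ℝ) ^ T * (2 : ℝ) ^ (XOf D T).size * (2 : ℝ) ^ (4 * D.size + 29).size * 1024 * (2 : ℝ) ^ j := by
    unfold precOf; rw [pow_add, pow_add, pow_add, pow_add]; norm_num
  rw [hp]
  rw [mul_div_assoc']
  rw [div_le_div_iff₀ (by positivity) (by positivity)]
  have h2j : (0 : ℝ) < (2 : ℝ) ^ j := by positivity
  have h2T : (0 : ℝ) < (2 : ℝ) ^ T := by positivity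
  have h2X : (0 : ℝ) < (2 : ℝ) ^ (XOf D T).size := by positivity
  have h2K : (0 : ℝ) < (2 : ℝ) ^ (4 * D.size + 29).size := by positivity
  have key : (((T : ℕ) : ℝ) * 2 ^ T * (((s0Of D : ℕ) : ℝ) + 1) + T + ((2 * MOf D T + 1 : ℕ) : ℝ) + 1) *
        (4 * (D.size : ℝ) + 29) ≤ (2 : ℝ) ^ T * (2 : ℝ) ^ (XOf D T).size * (2 : ℝ) ^ (4 * D.size + 29).size :=
    calc _ ≤ ((2 : ℝ) ^ T * XOf D T) * (4 * (D.size : ℝ) + 29) := mul_le_mul_of_nonneg_right hX hη0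
      _ ≤ ((2 : ℝ) ^ T * (2 : ℝ) ^ (XOf D T).size) * (2 : ℝ) ^ (4 * D.size + 29).size :=
          mul_le_mul (mul_le_mul_of_nonneg_left hXs h2T.le) hKs hη0 (by positivity)
  nlinarith [key]

/-- **The regulator is not tiny**: `N/8 + 1 ≤ N·R` for `N = 4096` (`R > (log 2)/2 > 1/4`). [cite: Jozsa2003, §7 Prop. 32] -/
theorem R_lower : (4096 : ℝ) / 8 + 1 ≤ 4096 * Real.log (fundUnit D) := by
  have h := HallgrenRegulator.log_two_lt_two_mul_log_fundUnit hD hD4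
  have h2 := Real.one_sub_inv_le_log_of_pos (by norm_num : (0 : ℝ) < 2)
  norm_num at h2
  linarith

end HallgrenGiantStep

end Literature.Computability.Cryptography

end
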